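import Mathlib
import Summits.Ventures.FusionMHD.Models.CerfonFreidbergIterLikeQHalfResDefs
import HarnessLib

/-!
# Ventures/FusionMHD — Models/CerfonFreidbergIterLikeQHalfResPanels3.lean: KERNEL CHECK of the resistive-register certificates of panel(s) 2, 3 (of 32)
# at `ψ_N = 1/2` of THE Cerfon–Freidberg ITER-like instance

HONEST FRAMING (LADDER-GRIDFUSION three columns; CF rung; rider «D_R at ψ_N = 1/2»).  One `decide +kernel` (≈ 60–90 s): for each listed panel the obligation
`CFIterLike.QHalfRes.ResCert.ok` (`Models/CerfonFreidbergIterLikeQHalfResDefs.lean`) — the Taylor-model run of `progR = progM ++ block3R` over ★ #117's parameter box is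
ACCEPTED and the kernel's two panel-integral enclosures (`g_AG`, `g_W` along the approximant) lie inside the claimed integers (compiled `#eval` of the same functions, slack
one unit of `2⁻⁶⁰`; float truth inside every panel, `genqm/truthR.json`).  MODELLED: analytic Cerfon–Freidberg family; nothing about a device or stability.
No `native_decide`.  Typer/prover: gridfusion-model-7 (g7), 2026-08-28.  Citations: Zheng 2015 §3.2 (3.42) [Zheng2015];
Mahboubi–Melquiond–Sibut-Pinote 2016 §3.2 Lemma 3 [MahboubiMelquiondSibutpinote2016].
-/

namespace Summit.Ventures.FusionMHD.Models.CFIterLike.QHalfRes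

/-- Resistive-register certificate data of panel(s) 2, 3. [instance data] -/
def resCert3 : List ResCert := [
  { j := 2, cand1 := [98564699531487903744, 106710486920901279744, 754663374828730449920, 959766082141159686144, 3761982538968425037824, 5708279244933533007872, 16654010334320818913280, 28516058007295039111168, 275486811546701579419648, -5838272930158091972902912, -806652187105551092606304256, 9852798187344104227522740224, 1146403882677143825407945998336],
    cand2 := [120593668033632845824, 76405162992392011776, 538672340088679038976, 666982248414452908032, 2648756934096627695616, 4263881214407003865088, 12617833299029866315776, 23232860798899772719104, -141550299566453139963904, -7515210516129662059413504, 958133068790696720564486144, 11506630919426915978379788288, -1583363855315127300926314905600],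
    deg := 10, e1 := 41, e2 := 42, glo := 3688232433130296, ghi := 3688232704357171, wlo := 145289348622409866, whi := 145289357799212039 },
  { j := 3, cand1 := [102669442153894166528, 157178384837591400448, 868683854075118092288, 1496968424831999016960, 4932185660309670723584, 9521492167560779530240, 24755227933662070702080, 48348918680470673162240, 73558803114719881199616, -138536340638979141402624, 219073774705746855795359744, 580838129332217855529189376, -389529286622645669350036471808],
    cand2 := [123530396810958340096, 112372307749640339456, 618218485470514511872, 1048223218511590588416, 3526474265690025492480, 7170363480790433529856, 19094836677717258141696, 38932655273319182893056, -448955531748183608655872, 556752840315710621089792, 1962573874780203621206196224, -1600329138383389458566217728, -2689473985324093875732334247936],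
    deg := 10, e1 := 41, e2 := 42, glo := 3760173238029798, ghi := 3760173509505955, wlo := 148849113931556835, whi := 148849123133205176 }]

/-- **KERNEL CHECK** of the two resistive registers on panel(s) 2, 3. -/
theorem resCert3_ok : CFIterLike.QHalfRes.resCert3.all ResCert.ok = true := by
  decide +kernel

end Summit.Ventures.FusionMHD.Models.CFIterLike.QHalfRes
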